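import Mathlib.NumberTheory.Cyclotomic.Basic
import Mathlib.NumberTheory.Cyclotomic.PrimitiveRoots
import Mathlib.LinearAlgebra.Matrix.GeneralLinearGroup.Defs
import Mathlib.FieldTheory.IsAlgClosed.Basic
import Literature.NumberTheory.Automorphic.ArithmeticQuotientCohomology
import Literature.NumberTheory.Automorphic.Eigenvariety
import Literature.NumberTheory.Automorphic.GLnAdelicStructure
import Literature.NumberTheory.GaloisRepresentations.InducedGaloisRep
import Literature.NumberTheory.GaloisRepresentations.RayClassGroupFinite
import HarnessLib

/-!
# Ash (2003), *Smith theory and Hecke operators*: induced mod `p` ray class characters of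
# `ℚ(ζ_p)` are attached to mod `p` Hecke eigenclasses of `GL_{p-1}` over `ℚ`

Topic `NumberTheory/Automorphic`; namespace `Literature.NumberTheory.Automorphic`, with the
paper-specific vocabulary grouped under `Ash2003`.  This file VENDORS the main theorem of

* A. Ash, *Smith theory and Hecke operators*, J. Algebra **259** (2003) 43–58
  [Ash2003] (read in full: pp. 43–58; Zbl 1045.11034),

as a NAMED FACT (`def Ash2003_inducedRayClassCharacter_attached : Prop`, not proved here),
together with the definitions needed to type it.  Nothing in this file is an open problem.

## The printed statements

Notation of the paper (§0–§1, pp. 44–46): `p` an ODD prime, `n = p - 1`, `F` a fixed algebraic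
closure of `ℤ/p`; `Γ = SL(n, ℤ)`; for `M ≥ 1`, `S_M(M)` = the integral matrices of positive
determinant prime to `M` congruent to `diag(1, …, 1, *)` mod `M`, `Γ(M) = Γ ∩ S_M(M)` the principal
congruence subgroup (torsion-free for `M > 2`), `ℋ` the `F`-algebra of double cosets
`Γ(M) \ S_M(M) / Γ(M)`, `T(l, k) = Γ(M) D(l,k) Γ(M)` (`l ∤ M` prime, `0 ≤ k ≤ n`, `D(l,k) ∈ S_M(M)` with
`Γ D(l,k) Γ = Γ diag(1,…,1,l,…,l) Γ`, `k` entries `l` — §6 and Lemma 6.1, `det = l^k`).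

* **Definition 0.1** (p. 44). `v` an `ℋ`-eigenclass with `T(l,k) v = a(l,k) v` for `k = 0,…,n` and
  all `l` prime to `M`; `ρ : G_ℚ → GL(n, F)` continuous semisimple, unramified outside `pM`, with
  `∑_k (-1)^k l^{k(k-1)/2} a(l,k) X^k = det(I - ρ(Frob_l) X)` for all `l ∤ pM`.  Then *`ρ` is
  attached to `v`*.
* **Theorem 1.1** (p. 46; proved as Theorem 4.5, p. 50). `ζ` a primitive `p`-th root of unity,
  `L = ℚ(ζ)`, `E` the ray class group of `L` of conductor `M = pN` with `p ∤ N` ("because the target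
  has no `p`-torsion we can and will assume that `p` divides `M` exactly once"), `θ : E → F^×` a
  character, viewed by class field theory as a character of `G_L`, `ρ = Ind(G_L, G_ℚ, θ)`,
  `n = p - 1`.  *Then there exist a character `η : (ℤ/M)^× → F^×` and `β ∈ H^*(Γ(M), F_η)` which is an
  eigenclass for the action of the Hecke algebra `ℋ` such that `ρ` is attached to `β`.*
* **Corollary 4.4** (p. 50, the adelic form from which 4.5 = 1.1 is deduced by comparing the
  adelic operators `T_s` with the classical ones, proof of Thm. 4.5). With
  `X = X(M) = G(ℚ) \ G(𝔸) / Z_∞ K_∞ K_f(M)` (`G = GL_n`, `K_f(M) = ∏_{l ∤ M} GL_n(ℤ_l) × ∏_{l^e ∥ M} K_l(l^e)`,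
  §2 p. 47; `X(M) = ∐_{(ℤ/M)^×} Γ(M) \ X_∞`, p. 47) and the Hecke operators `T_s`,
  `s = diag(1,…,1,l,…,l)` acting through the `l`-component `K_l s_l K_l = ∐ s_{i,l} K_l`
  (`σ T_s = ∑_i σ s_{i,l}`, p. 47): *there is an `ℋ`-eigenvector `α` in `H_*(X)` with `ρ_θ` attached.*
* Architecture of the proof (for a future discharge): the Smith exact sequence for the conjugation
  action of the order-`p` element `π` (companion matrix of `X^{p-1} + ⋯ + 1`) made `ℋ`-equivariant
  (Lemmas 2.1–2.2); a lifting lemma for one-dimensional subquotients along exact sequences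
  (Lemmas 3.1–3.3, 4.1); the ray class group `E` acts simply transitively on the components of the
  relevant part `X_M` of the fixed-point set (Lemma 5.7) and `T_s` acts there through the classes
  `[λ_Q]`, `λ_Q = ∏_{i ∈ Q} 𝔩_i` over the `k/d`-subsets `Q` of the primes of `L` above `l`
  (Theorem 6.2); hence the eigencharacter `χ_θ(T_{l,k}) = ∑_Q θ([λ_Q])` occurs (Theorem 4.3), and
  `χ_θ` has `ρ_θ` attached (Lemma 4.2, from Ash, Duke Math. J. 65 (1992), Thm. 6.1.2).

## What is vendored, and how it is typed

The fact `Ash2003_inducedRayClassCharacter_attached` is Theorem 1.1 in the **adelic cohomological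
form** of Corollary 4.4: an eigenclass in `H^i(X(M), F)` for some `i`, for the adelic operators
`T_{l,k} = [K_f(M) s_{l,k} K_f(M)]`.  The paper proves the homological statement and states the
main theorem in cohomology, the two being interchangeable ("we can (and will) work with homology
since it is algebraically dual to cohomology", p. 46; Hecke operators on cohomology are the
adjoints, Remark after Lemma 2.2), and deduces the classical form `β ∈ H^*(Γ(M), F_η)` from the
adelic one through `H_*(X) = ⊕_{(ℤ/M)^×} H_*(Γ(M), F)` (proof of Thm. 4.5).  We type:

* `H^i(X(M), F)` as `Ash2003.cohomology n M F i :=`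
  `ArithmeticQuotient.cohomology F ι⁺ K_f(M) F i = H^i(GL_n(ℚ)⁺, Fun(GL_n(𝔸_ℚ^∞) / K_f(M), F))`
  (`Literature.NumberTheory.Automorphic.ArithmeticQuotient.cohomology`, the tree's definition of the
  cohomology of the arithmetic quotient `Γ \ (X_∞ × 𝒢 / L)` for contractible `X_∞`).  Here
  `Γ = GL_n(ℚ)⁺` (Mathlib `Matrix.GLPos`) acting on the CONNECTED symmetric space
  `X_∞⁺ = GL_n(ℝ)⁺ / ℝ_{>0} SO(n)`, so that `GL_n(ℚ) \ (GL_n(ℝ)/ℝ_{>0}SO(n) × 𝒢/K_f) = GL_n(ℚ)⁺ \ (X_∞⁺ × 𝒢/K_f)`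
  has the paper's `φ(M)` components `Γ(M) \ X_∞⁺` (p. 47; the paper writes `K_∞ = O(n)`, but its
  component count `∐_{(ℤ/M)^×}` and its use of `H_*(X) = ⊕_{φ(M)} H_*(Γ(M))` are those of `SO(n)`);
  `K_f(M) = Ash2003.finiteLevel n M`, the finite part of the tree's
  `principalCongruenceLevel n ℚ (M)`; `ι⁺` the diagonal embedding.
* `T_{l,k}` as `Ash2003.heckeT … v k`, the tree's `ArithmeticQuotient.heckeEnd` of
  `Ash2003.heckeElement n v k = diag(l,…,l,1,…,1)_l` (`k` copies of the local idele at `v = (l)` of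
  the rational prime `l = q_v` itself, `Ash2003.localPrime`; identity entries elsewhere and at the
  other places; tree `glDiagonal`, `uniformizerIdele`), i.e. the paper's `s_l` up to the order of
  the diagonal entries (a permutation matrix in `GL_n(ℤ_l) ≤ K_f(M)`, `l ∤ M`), acting through its
  `l`-component only, exactly as `σ T_s = ∑_i σ s_{i,l}` (p. 47).  (Any other uniformizer of `ℚ_l`
  gives the same double coset; this is not used.)
* `Γ = GL_n(ℚ)⁺` rather than `GL_n(ℚ)`: the latter yields the quotient of `X(M)` by an involution
  (`diag(1,…,1,-1)`) commuting with all `T_{l,k}`, whose mod-`p` cohomology is a Hecke-stable direct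
  summand of `H^*(X(M), F)` (`p` odd), so the statement below is implied by either reading of the
  paper's `K_∞`.
* "attached" (Def. 0.1) as `Ash2003.IsAttached p M ρ a`, in the tree's conventions: ARITHMETIC
  Frobenius (`FramedGaloisRep.HasFrobCharpolyAt`) and monic characteristic polynomial, i.e.
  `charpoly ρ(Frob_l) = ∑_k (-1)^k l^{k(k-1)/2} a(l,k) X^{n-k}` — the tree's Hecke–Frobenius
  polynomial `heckeFrobPoly l n (a l)` of `Eigenvariety.lean` (Hansen's Def. 1.2.1, the same
  normalisation as Ash's), which is `det(I - ρ(Frob_l) X) = ∑_k (-1)^k l^{k(k-1)/2} a(l,k) X^k` read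
  backwards.  Semisimplicity of `ρ`, part of Def. 0.1, is automatic for `ρ = Ind θ`
  (`[G_ℚ : G_L] = p - 1` is prime to `p`) and is not restated.
* Relation to the tree's other finite-adelic formalism for `GL_n`,
  `Literature.NumberTheory.Automorphic.BigHeckeGLn` (`CompletedCohomologyHeckeAlgebraGLn.lean`:
  `BigHeckeGLn.heckeElement`, `levelCohomology`, `heckeOnCohomology`, `IsAssociatedFamily`):
  `Ash2003.heckeElement n v k` is `BigHeckeGLn.heckeElement n ℚ v k` with the uniformiser
  `BigHeckeGLn.uniformizerAt v` replaced by the prime `l` itself (`Ash2003.localPrime v`; same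
  `GL_n(ℤ_l)`-double coset), `Ash2003.cohomology` uses `GL_n(ℚ)⁺` and functions (not the dual of
  the permutation module) as coefficients, and `Ash2003.IsAttached p M ρ a` is
  `BigHeckeGLn.IsAssociatedFamily _ {v | q_v ∣ pM} a ρ` as soon as `a v 0 = 1` (which holds for
  eigenclasses, `Ash2003.IsEigenclass.apply_zero`; the two Frobenius polynomials then agree) — so a
  later bridge between the two formalisms is locatable from either side.
* `θ` "viewed as a character of `G_L` by class field theory" as an explicit Galois avatar
  `ϑ : Γ_L →ₜ* GL_1(F)` with `Ash2003.IsGaloisAvatar`: `ϑ` is unramified at every prime `w ∤ 𝔪` with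
  `ϑ(Frob_w) = θ([w])` (arithmetic Frobenius ↔ class of the prime, Artin's normalisation
  [NeukirchANT1999, Ch. VI §7]); such a `ϑ` is unique (Chebotarev) and exists by class field
  theory, which this file does not import — the fact quantifies over it.  `ρ = Ind ϑ` is the tree's
  `FramedGaloisRep.induce ℚ _ ϑ` (`InducedGaloisRep`), of rank `(p-1)·1`.
* The statement "∀ θ ∃ eigenclass with `Ind ϑ_θ` attached" is insensitive to the two sign
  conventions involved (normalisation of the Artin map, arithmetic vs geometric Frobenius in
  Def. 0.1): flipping either replaces `ϑ` by `ϑ⁻¹`, and `Ind(ϑ⁻¹) ≅ (Ind ϑ)^∨` with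
  `charpoly((Ind ϑ)^∨(Frob⁻¹)) = charpoly((Ind ϑ)(Frob))`.

NOT here: the classical Hecke pair `(Γ(M), S_M(M))` and the twist `F_η` (Thm. 1.1 verbatim),
Corollary 1.2 (removing `p` from the level with a coefficient module `W`), the explicit
eigencharacter `χ_θ` of Theorem 4.3, and Conjecture 0.2 (Ash–Sinnott).

## References

* A. Ash, *Smith theory and Hecke operators*, J. Algebra 259 (2003) 43–58, Def. 0.1, Thm. 1.1,
  §2, Cor. 4.4, Thm. 4.5 [Ash2003].
* J. Neukirch, *Algebraic Number Theory* (1999), Ch. VI §1 (ray class groups), §7 (Artin symbol)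
  [NeukirchANT1999].
* P. Scholze, *On torsion in the cohomology of locally symmetric varieties*, Ann. of Math. 182
  (2015), §V.4 (the convention for `H^i(X_K, ·)` followed by `ArithmeticQuotient.cohomology`)
  [Scholze2015].
-/

noncomputable section

open scoped NumberField
open IsDedekindDomain Polynomial

namespace Literature.NumberTheory.Automorphic

namespace Ash2003

/-! ### The adelic Hecke module `H^i(X(M), F)` of `GL_n` over `ℚ` -/

section HeckeModule

variable (n : ℕ)

/-- The diagonal embedding `GL_n(ℚ) →* GL_n(𝔸_ℚ^∞)` (entrywise `algebraMap ℚ 𝔸_ℚ^∞`; Mathlib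
`Matrix.GeneralLinearGroup.map`). [folklore] -/
abbrev toFiniteAdelic : GL (Fin n) ℚ →* GL (Fin n) (FiniteAdeleRing (𝓞 ℚ) ℚ) :=
  Matrix.GeneralLinearGroup.map (algebraMap ℚ (FiniteAdeleRing (𝓞 ℚ) ℚ))

/-- `ι⁺ : GL_n(ℚ)⁺ →* GL_n(𝔸_ℚ^∞)`, the diagonal embedding restricted to the matrices of positive
determinant (Mathlib `Matrix.GLPos`): the group `G(ℚ)⁺` acting on the connected symmetric space
`X_∞⁺`, see the module docstring. [folklore] -/
def posDetToFiniteAdelic : Matrix.GLPos (Fin n) ℚ →* GL (Fin n) (FiniteAdeleRing (𝓞 ℚ) ℚ) :=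
  (toFiniteAdelic n).comp (Matrix.GLPos (Fin n) ℚ).subtype

/-- Unfolding lemma for `posDetToFiniteAdelic`. [folklore] -/
@[simp]
theorem posDetToFiniteAdelic_apply (g : Matrix.GLPos (Fin n) ℚ) :
    posDetToFiniteAdelic n g = toFiniteAdelic n (g : GL (Fin n) ℚ) :=
  rfl

/-- **The level `K_f(M) ≤ GL_n(𝔸_ℚ^∞)`** of [Ash2003, §2]: `∏_{l ∤ M} GL_n(ℤ_l) × ∏_{l^e ∥ M} K_l(l^e)`
with `K_l(l^e) = {g ∈ GL_n(ℤ_l) | g ≡ 1 mod l^e}`, i.e. the finite part of the tree's principal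
congruence subgroup `principalCongruenceLevel n ℚ (M) = {1} × K_f(M)` (pulled back along
`GLn.ofFinite : h ↦ (1, h)`). [cite: Ash2003, §2] -/
def finiteLevel (M : ℕ) : Subgroup (GL (Fin n) (FiniteAdeleRing (𝓞 ℚ) ℚ)) :=
  (principalCongruenceLevel n ℚ (Ideal.span {(M : 𝓞 ℚ)})).comap (GLn.ofFinite n ℚ)

variable {n} in
/-- Membership in `K_f(M)`: `(1, h)` lies in the principal congruence subgroup of level `(M)`.
[folklore] -/
theorem mem_finiteLevel_iff {M : ℕ} {h : GL (Fin n) (FiniteAdeleRing (𝓞 ℚ) ℚ)} :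
    h ∈ finiteLevel n M ↔
      GLn.ofFinite n ℚ h ∈ principalCongruenceLevel n ℚ (Ideal.span {(M : 𝓞 ℚ)}) :=
  Iff.rfl

/-- **`H^i(X(M), F)`**, the mod-`p` (or any-coefficient-field) cohomology of Ash's locally symmetric
space `X(M) = GL_n(ℚ) \ GL_n(𝔸_ℚ) / Z_∞ K_∞ K_f(M) = ∐_{(ℤ/M)^×} Γ(M) \ X_∞` [Ash2003, §2, p. 47], typed
as the tree's cohomology of the arithmetic quotient of level `K_f(M)` for the group `GL_n(ℚ)⁺`
acting on the contractible `X_∞⁺`: `H^i(GL_n(ℚ)⁺, Fun(GL_n(𝔸_ℚ^∞) / K_f(M), F))`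
(`ArithmeticQuotient.cohomology`; by Shapiro's lemma `= ⊕_{(ℤ/M)^×} H^i(Γ(M), F)`).
[cite: Ash2003, §2] -/
abbrev cohomology (M : ℕ) (F : Type) [Field F] (i : ℕ) : ModuleCat F :=
  ArithmeticQuotient.cohomology F (posDetToFiniteAdelic n) (finiteLevel n M) F i

/-- For `ℚ` the residue cardinality `q_v` of a finite place `v = (l)` is the prime `l`; this is the
nonzero element `l ∈ ℚ_l` (a uniformizer), as a unit of the completion. [folklore] -/
def localPrime (v : HeightOneSpectrum (𝓞 ℚ)) : (v.adicCompletion ℚ)ˣ :=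
  Units.mk0 (algebraMap ℚ (v.adicCompletion ℚ) (v.residueCard : ℚ)) <| by
    rw [_root_.map_ne_zero]
    exact_mod_cast (lt_trans zero_lt_one v.one_lt_residueCard).ne'

/-- Unfolding lemma for `localPrime`. [folklore] -/
@[simp]
theorem coe_localPrime (v : HeightOneSpectrum (𝓞 ℚ)) :
    (localPrime v : v.adicCompletion ℚ) = algebraMap ℚ (v.adicCompletion ℚ) (v.residueCard : ℚ) :=
  rfl

/-- **The Hecke element `s_{l,k} ∈ GL_n(𝔸_ℚ^∞)`** at the finite place `v = (l)`:
`diag(l, …, l, 1, …, 1)` with `k` copies of the local idele at `v` of the prime `l = q_v` (tree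
`uniformizerIdele`, `glDiagonal`; component `l` at `v`, `1` at the other places).  Up to the order
of the diagonal entries (a permutation matrix in `GL_n(ℤ_l)`) this is the `l`-component `s_l` of
the paper's `s = diag(1, …, 1, l, …, l)` (`k` entries `l`) [Ash2003, §2 p. 47, §6]; it is the
tree's `BigHeckeGLn.heckeElement n ℚ v k` (`CompletedCohomologyHeckeAlgebraGLn.lean`) with the
chosen uniformiser `BigHeckeGLn.uniformizerAt v` replaced by `l` (same double coset).
[cite: Ash2003, §2] -/
def heckeElement (v : HeightOneSpectrum (𝓞 ℚ)) (k : ℕ) : GL (Fin n) (FiniteAdeleRing (𝓞 ℚ) ℚ) :=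
  glDiagonal n (FiniteAdeleRing (𝓞 ℚ) ℚ) fun j =>
    if j.val < k then uniformizerIdele ℚ v (localPrime v) else 1

/-- `s_{l,0} = 1`. [folklore] -/
@[simp]
theorem heckeElement_zero (v : HeightOneSpectrum (𝓞 ℚ)) : heckeElement n v 0 = 1 := by
  refine Matrix.GeneralLinearGroup.ext fun i j => ?_
  simp [heckeElement]

/-- **The adelic Hecke operator `T_{l,k} = [K_f(M) s_{l,k} K_f(M)]` on `H^i(X(M), F)`**
(`(T f)(x K_f) = ∑_{h K_f ⊆ K_f s K_f} f(x h K_f)` on the coefficients, tree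
`ArithmeticQuotient.heckeEnd`): the operator `T_s`, `σ T_s = ∑_i σ s_{i,l}` with
`K_l s_l K_l = ∐_i s_{i,l} K_l`, of [Ash2003, §2, p. 47], transported to cohomology (adjoint, Remark
after Lemma 2.2). [cite: Ash2003, §2] -/
abbrev heckeT (M : ℕ) (F : Type) [Field F] (i : ℕ) (v : HeightOneSpectrum (𝓞 ℚ)) (k : ℕ) :
    Module.End F (cohomology n M F i) :=
  ArithmeticQuotient.heckeEnd F (finiteLevel n M) (heckeElement n v k) F (posDetToFiniteAdelic n) i

open CategoryTheory in
/-- `T_{l,0}` is the identity (the double coset of `1`). [folklore] -/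
theorem heckeT_zero (M : ℕ) (F : Type) [Field F] (i : ℕ) (v : HeightOneSpectrum (𝓞 ℚ)) :
    heckeT n M F i v 0 = LinearMap.id := by
  have h1 : ArithmeticQuotient.heckeRepHom F (finiteLevel n M) (heckeElement n v 0) F
      (posDetToFiniteAdelic n) = 𝟙 _ := by
    refine Rep.hom_ext (Representation.IntertwiningMap.ext (LinearMap.ext fun f => ?_))
    change ArithmeticQuotient.heckeFun F (finiteLevel n M) (heckeElement n v 0) F f = f
    rw [heckeElement_zero, ArithmeticQuotient.heckeFun_one, LinearMap.id_apply]
  change (groupCohomology.map (MonoidHom.id _) _ i).hom = _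
  rw [h1, groupCohomology.map_id]
  rfl

/-- **Hecke eigenclass with eigenvalues `a`** [Ash2003, Def. 0.1, first half]: `α ≠ 0` and
`T_{l,k} α = a(l,k) α` for every prime `l ∤ M` (finite place `v` of `ℚ` with residue characteristic
`q_v = l` not dividing `M`) and every `0 ≤ k ≤ n`.  Values `a v k` for `k > n` or `q_v ∣ M` are not
constrained. [cite: Ash2003, Def. 0.1] -/
def IsEigenclass (M : ℕ) (F : Type) [Field F] (i : ℕ) (α : cohomology n M F i)
    (a : HeightOneSpectrum (𝓞 ℚ) → ℕ → F) : Prop :=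
  α ≠ 0 ∧ ∀ v : HeightOneSpectrum (𝓞 ℚ), ¬ v.residueCard ∣ M →
    ∀ k ≤ n, heckeT n M F i v k α = a v k • α

variable {n} in
/-- For an eigenclass the eigenvalue of `T_{l,0} = 1` is `a(l,0) = 1`. [folklore] -/
theorem IsEigenclass.apply_zero {M : ℕ} {F : Type} [Field F] {i : ℕ} {α : cohomology n M F i}
    {a : HeightOneSpectrum (𝓞 ℚ) → ℕ → F} (h : IsEigenclass n M F i α a)
    {v : HeightOneSpectrum (𝓞 ℚ)} (hv : ¬ v.residueCard ∣ M) : a v 0 = 1 := by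
  have h0 := h.2 v hv 0 (Nat.zero_le n)
  rw [heckeT_zero, LinearMap.id_apply] at h0
  by_contra hne
  apply h.1
  have h2 : (a v 0 - 1) • α = 0 := by rw [sub_smul, one_smul, ← h0, sub_self]
  rcases smul_eq_zero.mp h2 with h3 | h3
  · exact absurd (sub_eq_zero.mp h3) hne
  · exact h3

end HeckeModule

/-! ### "Attached" Galois representations (Definition 0.1) -/

section Attached

/-- Ash's Hecke polynomial `∑_k (-1)^k l^{k(k-1)/2} a(l,k) X^k` of [Ash2003, Def. 0.1] read
backwards is the tree's `heckeFrobPoly q m a` (`Eigenvariety.lean`); in rank `2` it is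
`a₀ X² - a₁ X + q a₂` — for `a₀ = 1` the classical `X² - a_l X + l ⟨l⟩` of weight-two eigenforms
(sanity check of the exponents `l^{k(k-1)/2}`). [folklore] -/
theorem heckeFrobPoly_two {F : Type*} [CommRing F] (q : ℕ) (a : ℕ → F) :
    heckeFrobPoly q 2 a = C (a 0) * X ^ 2 - C (a 1) * X + C ((q : F) * a 2) := by
  simp only [heckeFrobPoly, Finset.sum_range_succ, Finset.sum_range_zero]
  simp only [map_mul]
  norm_num
  ring

/-- **`ρ` is attached to the system of Hecke eigenvalues `a`** [Ash2003, Def. 0.1, second half],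
for a continuous `ρ : G_ℚ → GL_m(F)` and the level data `(p, M)`: for every prime `l ∤ pM` (finite
place `v` of `ℚ`, `q_v = l`), `ρ` is unramified at `l` and the characteristic polynomial of an
arithmetic Frobenius at `l` is the Hecke–Frobenius polynomial of the eigenvalues (tree
`heckeFrobPoly`, `Eigenvariety.lean`, Hansen's Def. 1.2.1 — the same polynomial as Ash's),
`det(X - ρ(Frob_l)) = ∑_k (-1)^k l^{k(k-1)/2} a(l,k) X^{m-k}` (equivalently
`det(I - ρ(Frob_l) X) = ∑_k (-1)^k l^{k(k-1)/2} a(l,k) X^k`, the printed form).  Frobenius and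
charpoly conventions are the tree's (`FramedGaloisRep.IsUnramifiedAt`, `HasFrobCharpolyAt`); Def. 0.1
also asks `ρ` to be semisimple, which is not part of this predicate (see the module docstring).
For `a v 0 = 1` this is `BigHeckeGLn.IsAssociatedFamily m {v | q_v ∣ pM} a ρ`
(`CompletedCohomologyHeckeAlgebraGLn.lean`). [cite: Ash2003, Def. 0.1] -/
def IsAttached {F : Type*} [CommRing F] [TopologicalSpace F] {m : ℕ} (p M : ℕ)
    (ρ : GaloisRepresentations.FramedGaloisRep ℚ F m) (a : HeightOneSpectrum (𝓞 ℚ) → ℕ → F) :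
    Prop :=
  ∀ v : HeightOneSpectrum (𝓞 ℚ), ¬ v.residueCard ∣ p * M →
    ρ.IsUnramifiedAt v ∧ ρ.HasFrobCharpolyAt v (heckeFrobPoly v.residueCard m (a v))

end Attached

/-! ### The Galois avatar of a ray class character, the modulus `(M)` of `ℚ(ζ_p)` -/

section Galois

/-- **`ϑ` is the Galois character of the ray class character `θ` modulo `𝔪`** (what "by class field
theory we can view `θ` as a character of the absolute Galois group `G_L`" [Ash2003, §1, p. 45]
means, in Artin's normalisation [NeukirchANT1999, Ch. VI §7]): for every prime `w` of `L` coprime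
to `𝔪`, `ϑ : Γ_L →ₜ* GL_1(F)` is unramified at `w` and every arithmetic Frobenius at `w` has
characteristic polynomial `X - θ([w])`, `[w] ∈ Cl_L^𝔪` the ray class of `w` (tree
`integralRayClass`).  Such a `ϑ` is unique and exists by class field theory (not imported).
[cite: Ash2003, §1] -/
def IsGaloisAvatar {L : Type*} [Field L] [NumberField L] {F : Type*} [CommRing F]
    [TopologicalSpace F] {𝔪 : Ideal (𝓞 L)} (h𝔪 : 𝔪 ≠ ⊥)
    (θ : GaloisRepresentations.RayClassGroup 𝔪 →* Fˣ)
    (ϑ : GaloisRepresentations.FramedGaloisRep L F 1) : Prop :=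
  ∀ (w : HeightOneSpectrum (𝓞 L)) (hw : IsCoprime w.asIdeal 𝔪),
    ϑ.IsUnramifiedAt w ∧ ϑ.HasFrobCharpolyAt w
      (X - C ((θ (GaloisRepresentations.integralRayClass 𝔪 h𝔪 ⟨w.asIdeal, w.ne_bot, hw⟩) : Fˣ) : F))

/-- The modulus `𝔪 = M 𝒪_L` of a number field `L` attached to a positive integer `M` (for
`L = ℚ(ζ_p)`, `p` odd, totally complex, the ray class group `Cl_L^{(M)}` of the tree — narrow sense —
is the paper's ray class group "of conductor `M`"). [cite: Ash2003, §1] -/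
abbrev modulus (L : Type*) [Field L] [NumberField L] (M : ℕ) : Ideal (𝓞 L) :=
  Ideal.span {(M : 𝓞 L)}

/-- `(M) ≠ 0` for `M ≠ 0`. [folklore] -/
theorem modulus_ne_bot (L : Type*) [Field L] [NumberField L] {M : ℕ} (hM : M ≠ 0) :
    modulus L M ≠ ⊥ := by
  rw [Ne, Ideal.span_singleton_eq_bot]
  exact_mod_cast hM

/-- `[ℚ(ζ_p) : ℚ] = p - 1` for a prime `p` (Mathlib `IsCyclotomicExtension.finrank`,
`Nat.totient_prime`). [folklore] -/
theorem finrank_cyclotomicField (p : ℕ) [hp : Fact p.Prime] :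
    Module.finrank ℚ (CyclotomicField p ℚ) = p - 1 := by
  haveI : NeZero p := ⟨hp.out.ne_zero⟩
  -- Mathlib's instance is stated for `CyclotomicField.instAlgebra`; the statement uses the
  -- canonical `DivisionRing.toRatAlgebra` (the two agree definitionally, not reducibly).
  haveI : IsCyclotomicExtension {p} ℚ (CyclotomicField p ℚ) :=
    CyclotomicField.isCyclotomicExtension p ℚ
  rw [IsCyclotomicExtension.finrank (CyclotomicField p ℚ)
    (Polynomial.cyclotomic.irreducible_rat hp.out.pos), Nat.totient_prime hp.out]

end Galois

end Ash2003

/-! ### The named fact -/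

/-- **Ash (2003), Theorem 1.1 (= Theorem 4.5), in the adelic cohomological form of Corollary 4.4.**
Let `p` be an odd prime, `n = p - 1`, `F` an algebraic closure of `𝔽_p` (discrete), `N ≥ 1` prime to
`p`, `M = pN`, `L = ℚ(ζ_p)`, `θ : Cl_L^{(M)} → F^×` a character of the ray class group of `L` of
modulus `(M)`, and `ϑ : Γ_L → F^×` its Galois character (`Ash2003.IsGaloisAvatar`: unramified at
the primes `w ∤ M` with `ϑ(Frob_w) = θ([w])`).  Let `ρ = Ind_{Γ_L}^{Γ_ℚ} ϑ : Γ_ℚ → GL_{p-1}(F)`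
(`FramedGaloisRep.induce`).  Then there are a degree `i`, a class `α ≠ 0` in the mod-`p` cohomology
`H^i(X(M), F) = ⊕_{(ℤ/M)^×} H^i(Γ(M), F)` of the principal congruence subgroup `Γ(M) ≤ SL(p-1, ℤ)`
(`Ash2003.cohomology`) which is a simultaneous eigenclass of the Hecke operators `T_{l,k}`
(`l ∤ M`, `0 ≤ k ≤ n`) with eigenvalues `a(l,k)` (`Ash2003.IsEigenclass`), and `ρ` is attached to it
(`Ash2003.IsAttached`): `ρ` is unramified at every `l ∤ pM` and
`det(I - ρ(Frob_l) X) = ∑_{k=0}^{n} (-1)^k l^{k(k-1)/2} a(l,k) X^k`.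
Printed form: "there exists a character `η : (ℤ/M)^× → F^×` and a `β ∈ H^*(Γ(M), F_η)` which is an
eigenclass for the action of the Hecke algebra `ℋ` such that `ρ` is attached to `β`" (Thm. 1.1),
obtained in the paper from "there is an `ℋ`-eigenvector `α` in `H_*(X)` with `ρ_θ` attached"
(Cor. 4.4) — see the module docstring for the dictionary and the conventions.
[cite: Ash2003, Thm. 1.1 and Cor. 4.4] -/
def Ash2003_inducedRayClassCharacter_attached : Prop :=
  ∀ (p : ℕ) [Fact p.Prime], p ≠ 2 →
    ∀ (N : ℕ) (hN : N ≠ 0), ¬ p ∣ N →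
    ∀ (F : Type) [Field F] [Algebra (ZMod p) F] [IsAlgClosure (ZMod p) F] [TopologicalSpace F]
      [DiscreteTopology F]
      (θ : GaloisRepresentations.RayClassGroup (Ash2003.modulus (CyclotomicField p ℚ) (p * N)) →* Fˣ)
      (ϑ : GaloisRepresentations.FramedGaloisRep (CyclotomicField p ℚ) F 1),
      Ash2003.IsGaloisAvatar
          (Ash2003.modulus_ne_bot (CyclotomicField p ℚ)
            (mul_ne_zero (Nat.Prime.ne_zero Fact.out) hN))
          θ ϑ →
        ∃ (i : ℕ) (α : Ash2003.cohomology (p - 1) (p * N) F i)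
          (a : HeightOneSpectrum (𝓞 ℚ) → ℕ → F),
          Ash2003.IsEigenclass (p - 1) (p * N) F i α a ∧
            Ash2003.IsAttached p (p * N)
              (GaloisRepresentations.FramedGaloisRep.induce ℚ (Ash2003.finrank_cyclotomicField p) ϑ) a

end Literature.NumberTheory.Automorphic
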